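import Literature.Analysis.FluidPDE.LeiZhang2011Proofs
import Literature.Analysis.FluidPDE.CylindricalAxisBoundary
import HarnessLib

/-!
# Lei–Zhang 2011, §3: the axis term of the energy identities for solutions that do not vanish
# on the axis

Analysis/FluidPDE proofs file (theorems only), on the discharge path of the named fact
`Literature.Analysis.FluidPDE.LeiZhang2011_liouville` (Z. Lei, Q. S. Zhang, J. Funct. Anal. 261
(2011) = arXiv:1011.5066, Theorem 1.2 via Theorem 1.1). In §3 the equation (1.5) is tested for
the normalised positive solution `Φ = 2(M − Γ)/J` (or `2(Γ − m)/J`), which equals a non-zero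
constant `a` on the axis; the axis term then produces boundary contributions
(Lemma 3.4, p. 11: "`−∬ (2/r)(∂ᵣΦ^p)ψ² = ∬ Φ^p (4/|y'|)ψ∂_{|y'|}ψ + ∫ds∫ 2Φ^pψ²|_{r=0} dz`";
Lemma 3.2, p. 9). This file provides the corresponding slice identity, the companion of
`integral_two_div_cylRadius_mul_fderiv_eR_mul_deriv_comp_mul_sq` (`LeiZhang2011Proofs`, the case
`F = 0` on the axis, `H(0) = 0`) without any vanishing assumption:

`∫ (2/r) ∂ᵣF · H'(F) φ² dx = −∫ (2/r) H(F) ∂ᵣ(φ²) dx − 2c₂ ∫ H(F(0,0,z)) φ(0,0,z)² dz`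

(`LeiZhang2011.integral_axis_term_eq_sub_boundary`), from the tree's
`integrable_and_integral_two_div_cylRadius_mul_fderiv_eR_axis` (`CylindricalAxisBoundary`) applied
to `H ∘ F` and `φ²`; `c₂ = radialConst₂ = 2π`, `(0,0,z) = meridianPoint (0, z)`.

## References

* Z. Lei, Q. S. Zhang, J. Funct. Anal. 261 (2011) = arXiv:1011.5066, §3, proof of Lemma 3.4
  (p. 11) and of Lemma 3.2 (p. 9). [LeiZhang2011]
-/

noncomputable section

open MeasureTheory Set Function Filter Metric
open _root_.Topology
open scoped InnerProductSpace RealInnerProductSpace NNReal ENNReal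

namespace Literature.Analysis.FluidPDE

namespace LeiZhang2011

/-- **The axis term with its boundary contribution** (Lei–Zhang 2011, Lemma 3.4, p. 11, and
Lemma 3.2, p. 9): for an axisymmetric `F ∈ C¹`, `H ∈ C¹` and an axisymmetric cut-off `φ ∈ C¹_c`
(no vanishing of `F` on the axis, no `H(0) = 0`),
`∫ (2/r) ∂ᵣF H'(F) φ² = −∫ (2/r) H(F) ∂ᵣ(φ²) − 2c₂ ∫ H(F(0,0,z)) φ(0,0,z)² dz`, and both volume
integrands are integrable. With `F = 0` on the axis and `H(0) = 0` the boundary term vanishes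
(`integral_two_div_cylRadius_mul_fderiv_eR_mul_deriv_comp_mul_sq`). [cite: LeiZhang2011, proof of Lemma 3.4 (arXiv p. 11), the axis boundary term] -/
theorem integral_axis_term_eq_sub_boundary {F : EuclideanSpace ℝ (Fin 3) → ℝ}
    (hF : ContDiff ℝ 1 F) (hFa : IsAxisymmetricScalar F) {H : ℝ → ℝ} (hH : ContDiff ℝ 1 H)
    {φ : EuclideanSpace ℝ (Fin 3) → ℝ} (hφ : ContDiff ℝ 1 φ) (hφc : HasCompactSupport φ)
    (hφa : IsAxisymmetricScalar φ) :
    Integrable (fun x => 2 / cylRadius x * (fderiv ℝ F x (eR x) * (deriv H (F x) * φ x ^ 2)))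
      (volume : Measure (EuclideanSpace ℝ (Fin 3))) ∧
    Integrable (fun x => 2 / cylRadius x * (H (F x) * fderiv ℝ (fun y => φ y ^ 2) x (eR x)))
      (volume : Measure (EuclideanSpace ℝ (Fin 3))) ∧
    ∫ x, 2 / cylRadius x * (fderiv ℝ F x (eR x) * (deriv H (F x) * φ x ^ 2)) =
      (-∫ x, 2 / cylRadius x * (H (F x) * fderiv ℝ (fun y => φ y ^ 2) x (eR x))) -
        2 * radialConst₂ *
          ∫ z : ℝ, H (F (meridianPoint (0, z))) * φ (meridianPoint (0, z)) ^ 2 := by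
  have hHF : ContDiff ℝ 1 fun x => H (F x) := hH.comp hF
  have hHFa : IsAxisymmetricScalar fun x => H (F x) := fun θ x => by simp only [hFa θ x]
  have hφ2 : ContDiff ℝ 1 fun y => φ y ^ 2 := hφ.pow 2
  have hφ2c : HasCompactSupport fun y => φ y ^ 2 :=
    hφc.comp_left (g := fun t : ℝ => t ^ 2) (by simp)
  have hφ2a : IsAxisymmetricScalar fun y => φ y ^ 2 := fun θ x => by simp only [hφa θ x]
  obtain ⟨hi1, hi2, heq⟩ :=
    integrable_and_integral_two_div_cylRadius_mul_fderiv_eR_axis hHF hφ2 hφ2c hHFa hφ2a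
  -- `∂ᵣ(H∘F) = H'(F) ∂ᵣF`
  have hd : ∀ x, fderiv ℝ (fun y => H (F y)) x = deriv H (F x) • fderiv ℝ F x := fun x =>
    ((((hH.differentiable one_ne_zero) (F x)).hasDerivAt).comp_hasFDerivAt x
      ((hF.differentiable one_ne_zero) x).hasFDerivAt).fderiv
  have hpt : ∀ x, 2 / cylRadius x * (fderiv ℝ (fun y => H (F y)) x (eR x) * φ x ^ 2) =
      2 / cylRadius x * (fderiv ℝ F x (eR x) * (deriv H (F x) * φ x ^ 2)) := by
    intro x
    simp only [hd x, FunLike.coe_smul, Pi.smul_apply, smul_eq_mul]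
    ring
  have hfun : (fun x => 2 / cylRadius x * (fderiv ℝ (fun y => H (F y)) x (eR x) * φ x ^ 2)) =
      fun x => 2 / cylRadius x * (fderiv ℝ F x (eR x) * (deriv H (F x) * φ x ^ 2)) :=
    funext hpt
  rw [hfun] at hi1 heq
  exact ⟨hi1, hi2, heq⟩

end LeiZhang2011

end Literature.Analysis.FluidPDE
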